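import Summits.QuantumFields.BalabanUV.T4Continuum.Support.NE7TopNormalisedResidualLetters
import Summits.QuantumFields.BalabanUV.T4Continuum.Support.NE7PureGaugePieceLetters
import HarnessLib

/-!
# Support | NE7 (gen 98, ROAD-Γ′ S5-conditional — THE `hdecomp♭` DECOMPOSITION AND ITS TWO LETTERS FROM A TOP-NORMALISED REPRESENTATIVE, MODULO THE THREE MASSES OF
# THE SLICE-CORRECTING GENERATOR): at NE7's pair with `v_{j+1} ≡ 1`, `X = X_T + X_N`, `X_T ∈ T_♮(W)`, `X_N = spikes + rightInvW(D(X − spikes)) − gaugeDir W μ`, with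
# `‖X_N‖_w ≤ (ν_S + ν_R + ν_μ)‖X‖_w` and `x·Σ‖curl_W X_N‖ ≤ (κ_S + κ_R + κ_μ)‖X‖_w²` — where `μ` is leaf-02's corner-trivial generator putting the TANGENT residual into the
# slice and `ν_μ = √(4(M²x)²·#Plane·p₂ + m₂)`, `κ_μ = 2·#Plane·(M²x)²·m₁` are read from its three masses `M⁻²‖gaugeDir W μ‖₂² ≤ m₂‖X‖_w²`, `Σ‖μ‖² ≤ p₂M⁴‖X‖_w²`, `Σ‖μ‖ ≤ m₁M³‖X‖_w²`

Cell `pub-balaban`, rung (B)+1 sub-cell t4, lineage `b2b-balaban-t4-ne7-p1` (CRUX PROVER NE7 #1 = OWNER of row NE7), generation 98; memo `t4/b2b-balaban-t4-ne7-p1-g98/ROAD-G98.md` §3.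
Pure composition BY NAME of S4a `NE7TopNormalisedResidualLetters.tangentResidual_letters_of_frameTrivial` (the tangent residual `X − X_N⁰` and the letters of `X_N⁰`), leaf-02's
`NE3FrameFreeDecompositionW.exists_cornerGauge_mem_frameFreeBlockLandauW` (every skew periodic TANGENT field is put into `T_♮(W)` by a corner-trivial gauge generator), S4b part 1
`NE7PureGaugePieceLetters` (`curlSq` and ℓ¹-curl of a gauge direction from the masses of its generator), row NE3's seminorm bookkeeping `NE3ProductPathBounds.energyNormW_sub_le ∕
curl_sub_dir`, and `NE3TangentCovariantTower.tangentIter_iff_dirIter_eq_zero`.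

WHY (memo ROAD-G97 §4, ROAD-G98 §3).  The honest per-pair binder `hdecomp♭` of the END `NE7HintOfSliceNormalisationSU2Dec.hint_SU2_of_decomposition` asks a unitary gauge `u` and
`U′^{u} = U_s·e^{X}`, `X = X_T + X_N`, `X_T ∈ T_♮(U_s)`, `‖X_N‖_w ≤ ν‖X‖_w`, `(ε∕M²)Σ‖curl X_N‖ ≤ κ‖X‖_w²`, `sup‖X‖·M ≤ α̂`, k-free `ν ≤ ν̂`, `κ ≤ κ̂`.  ROAD-Γ′ supplies it from
(S1∕S2) a TOP-NORMALISED representative (`v_{j+1} ≡ 1`, sup `b` with `Mb ≤ α̂`) and (S3∕S4) the split of THIS file.  Here the split and BOTH letters are a kernel theorem MODULO the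
three masses of leaf-02's generator `μ` for the tangent residual — stated as the hypothesis `hμ` (for EVERY admissible `μ`; leaf-02's decomposition is unique, `frameFreeW_decomposition_unique`):
`m₂` (the `M⁻²`-weighted Hilbert–Schmidt mass of `gaugeDir W μ` — Pythagoras `NE7SliceLinearSplit.riesz_pythagoras` on the second-order field once S1 has removed the first-order
Ξ₀₀-component), `p₂` (`Σ‖μ‖²`, from `m₂` by the block Poincaré inequality on `Ξ₀`), `m₁` (`Σ‖μ‖`, the Green's-function letter (G-ℓ¹) of memo §2 — [Balaban1983RegularityDecay]
Thm (1.10) TYPE, in the tree for abelian regular fields as `B4ThmTorusPairEta.thmPrintedNN_torusPairFam`).  With `x = ε∕M²`: `ν_μ² = 4ε²·#Plane·p₂ + m₂`, `κ_μ = 2·#Plane·ε²·m₁`.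
WHAT ([folklore]; 0 def, 0 sorry).  §1 `energyNormW_gaugeDir_le_of_masses`, `curlL1_gaugeDir_le_of_mass` (the pure gauge piece in relative currency); §2
**`decomp_of_topNormalised`** — `∃ X_T X_N ν κ`: `X = X_T + X_N`, `X_T ∈ frameFreeBlockLandauW L N (j+1) W`, `X_N` skew, `‖X_N‖_w ≤ ν‖X‖_w`, `x·Σ_{perWin(N·M)}‖curl_W X_N‖ ≤ κ‖X‖_w²`,
`ν = ν_S + ν_R + ν_μ`, `κ = κ_S + κ_R + κ_μ` explicit and k-FREE given the ceilings `Γ₁…Γ₄` and the masses.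
HONEST FRAMING (page 1): composition and real arithmetic over landed kernel theorems; nothing of Bałaban's asserted; the top-normalised representative (S1∕S2), the three masses
(`hμ`), `hdecomp♭` and NE7 are NOT proved; spine 0∕9; finite T⁴ rung (B)+1 — NOT infinite volume, NOT mass gap, NOT `BetaPertH`, NOT Clay.  Continuum YM on T⁴ ⇐ BetaPertH ∧ nine
spine estimates (0/9 proved); BetaPertH ⇐ (D1) ∧ (D4) ∧ CAP+tail; G-an2-4 gates asym, D1 and NE2/3/4.
-/

set_option autoImplicit false

open scoped BigOperators Matrix Matrix.Norms.L2Operator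
open NormedSpace Finset

namespace Summit.QuantumFields.BalabanUV.T4Continuum.NE7DecompOfTopNormalised

open Literature.MathematicalPhysics.QuantumFieldTheory.Balaban1983to89
open B7Prop1Explicit B7Prop2Explicit B7Prop3Flat MatrixLog
open T4AveragingDeficitWall (Ad IsUnitaryCfg IsSkewDir SmallField vary curl dirL1 dirSq curlSq)
open T4AveragingDeficitWallBoundary (IsPeriodicCfg periodBox)
open AveragingDeficitPeriodicCounting (IsPeriodicDir)
open AveragingDeficitMultiLevelPrep (cavgIter LevelSmall tower TangentIter)
open B7Eq92Concrete (vcov)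
open NE3TangentCovariantTower (dirIter QbarIter framePotW tangentIter_iff_dirIter_eq_zero)
open NE3.PairLandauB8Avg (relPert)
open ReplicationRightInverseBound (radSum)
open BlockAverageVaryHolo (nbRad)
open NE3CovariantLineSumsError (Csup)
open ShellMeasureAverageProp4General (C1cov C1cov_pos)
open BlockAveragePushDirGauge (gaugeDir isPeriodicDir_gaugeDir)
open NE3CornerSpikes (spikeW)
open NE3QbarIterCovLiftPrep (cruxC)
open NE3SmoothRightInverseW (rightInvW)
open NE3RightInverseSolveLetters (thetaLoc)
open NE3RightInverseL2Letter (l2C l2C_nonneg)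
open NE3HatInvCurlLetters (curl2C curl1C curl2C_nonneg curl1C_nonneg)
open NE3EnergyWeightedShapes (energyNormW energyNormW_nonneg)
open NE3ProductPathBounds (energyNormW_sub_le curl_sub_dir)
open NE3EnergyHessContTwoTerm (curlSq_nonneg dirSq_nonneg)
open NE3SmoothLiftW (tower_eq_pow_mul)
open NE3LandauOrbit (gaugeDir_skew)
open NE3FrameFreeSliceW (frameFreeBlockLandauW)
open NE3FrameFreeDecompositionW (exists_cornerGauge_mem_frameFreeBlockLandauW)
open NE3CurlOfGaugeDir (curlSq_gaugeDir_le)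
open MinimalActionLevels (perWin)
open NE7TopNormalisedSpikeEnergyLetters (energyNormW_le_of_sq_le sq_mul_le_sq_of_one_le)
open NE7TopNormalisedResidualLetters (tangentResidual_letters_of_frameTrivial)
open NE7PureGaugePieceLetters (sum_norm_curl_gaugeDir_le)

noncomputable section

variable {d : ℕ} {n : Type*} [Fintype n] [DecidableEq n]

/-! ## §1 The pure gauge piece in relative currency -/

/-- **THE ν-LETTER OF A PURE GAUGE PIECE FROM ITS TWO ℓ² MASSES** (`M = L^{j+1} ≥ 1`, `W` unitary with `SmallField W x`, `x ≥ 0`): if `dirSq (gaugeDir W μ) F ≤ m₂·M²·E²` and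
`Σ_F‖μ‖² ≤ p₂·M⁴·E²` (`m₂, p₂, E ≥ 0`) then `‖gaugeDir W μ‖_w ≤ √(4(M²x)²·#Plane·p₂ + m₂)·E` (`curlSq ≤ 4x²·#Plane·Σ‖μ‖²`, `NE3CurlOfGaugeDir.curlSq_gaugeDir_le`). [folklore] -/
theorem energyNormW_gaugeDir_le_of_masses [Nonempty n] {L : ℕ} (hL : 1 ≤ L) (j : ℕ) {W : Site d → Fin d → (Matrix n n ℂ)ˣ} (hW : IsUnitaryCfg W) {x : ℝ}
    (hWx : SmallField W x) (μ : Site d → Matrix n n ℂ) (F : Finset (Site d)) {m₂ p₂ E : ℝ} (hm₂ : 0 ≤ m₂) (hp₂ : 0 ≤ p₂) (hE : 0 ≤ E)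
    (hD : dirSq (gaugeDir W μ) F ≤ m₂ * ((L : ℝ) ^ (j + 1)) ^ 2 * E ^ 2) (hS : ∑ z ∈ F, ‖μ z‖ ^ 2 ≤ p₂ * ((L : ℝ) ^ (j + 1)) ^ 4 * E ^ 2) :
    energyNormW L (j + 1) W (gaugeDir W μ) F
      ≤ Real.sqrt (4 * (((L : ℝ) ^ (j + 1)) ^ 2 * x) ^ 2 * (Fintype.card (T4AveragingDeficitWall.Plane d)) * p₂ + m₂) * E := by
  have hL0 : (0 : ℝ) < L := by exact_mod_cast (show 0 < L by omega)
  set M : ℝ := (L : ℝ) ^ (j + 1) with hMdef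
  have hM0 : 0 < M := by positivity
  set P : ℝ := (Fintype.card (T4AveragingDeficitWall.Plane d) : ℝ) with hPdef
  have hP0 : 0 ≤ P := by rw [hPdef]; positivity
  have hcurl : curlSq W (gaugeDir W μ) F ≤ 4 * x ^ 2 * P * ∑ z ∈ F, ‖μ z‖ ^ 2 := curlSq_gaugeDir_le hW hWx μ F
  set c : ℝ := Real.sqrt (4 * (M ^ 2 * x) ^ 2 * P * p₂ + m₂) * E with hc
  have hc0 : 0 ≤ c := by rw [hc]; positivity
  refine energyNormW_le_of_sq_le L j W _ F hc0 ?_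
  have hsq : Real.sqrt (4 * (M ^ 2 * x) ^ 2 * P * p₂ + m₂) ^ 2 = 4 * (M ^ 2 * x) ^ 2 * P * p₂ + m₂ := Real.sq_sqrt (by positivity)
  have e : c ^ 2 = (4 * (M ^ 2 * x) ^ 2 * P * p₂ + m₂) * E ^ 2 := by rw [hc, mul_pow, hsq]
  rw [e]
  have hMinv : (M⁻¹) ^ 2 * (m₂ * M ^ 2 * E ^ 2) = m₂ * E ^ 2 := by field_simp
  calc curlSq W (gaugeDir W μ) F + (M⁻¹) ^ 2 * dirSq (gaugeDir W μ) F
      ≤ 4 * x ^ 2 * P * (∑ z ∈ F, ‖μ z‖ ^ 2) + (M⁻¹) ^ 2 * (m₂ * M ^ 2 * E ^ 2) := add_le_add hcurl (mul_le_mul_of_nonneg_left hD (by positivity))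
    _ ≤ 4 * x ^ 2 * P * (p₂ * M ^ 4 * E ^ 2) + (M⁻¹) ^ 2 * (m₂ * M ^ 2 * E ^ 2) := by gcongr
    _ = (4 * (M ^ 2 * x) ^ 2 * P * p₂ + m₂) * E ^ 2 := by rw [hMinv]; ring

/-- **THE κ-LETTER OF A PURE GAUGE PIECE FROM ITS ℓ¹ MASS** (`M = L^{j+1} ≥ 1`, `x, m₁ ≥ 0`): if `Σ_{[0,P)^d}‖μ‖ ≤ m₁·M³·E²` then `x·Σ_{perWin P}‖curl_W (gaugeDir W μ)‖ ≤ 2·#Plane·(M²x)²·m₁·E²`.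
[folklore] -/
theorem curlL1_gaugeDir_le_of_mass [Nonempty n] {L : ℕ} (hL : 1 ≤ L) (j : ℕ) (Pr : ℕ) {W : Site d → Fin d → (Matrix n n ℂ)ˣ} (hW : IsUnitaryCfg W) {x : ℝ} (hx : 0 ≤ x)
    (hWx : SmallField W x) (μ : Site d → Matrix n n ℂ) {m₁ E : ℝ} (hm₁ : 0 ≤ m₁)
    (hS : ∑ z ∈ periodBox (d := d) Pr, ‖μ z‖ ≤ m₁ * ((L : ℝ) ^ (j + 1)) ^ 3 * E ^ 2) :
    x * ∑ p ∈ perWin d Pr, ‖curl W (gaugeDir W μ) p‖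
      ≤ 2 * (Fintype.card (T4AveragingDeficitWall.Plane d)) * (((L : ℝ) ^ (j + 1)) ^ 2 * x) ^ 2 * m₁ * E ^ 2 := by
  have hL0 : (0 : ℝ) < L := by exact_mod_cast (show 0 < L by omega)
  set M : ℝ := (L : ℝ) ^ (j + 1) with hMdef
  have hM1 : 1 ≤ M := one_le_pow₀ (by exact_mod_cast hL)
  set P : ℝ := (Fintype.card (T4AveragingDeficitWall.Plane d) : ℝ) with hPdef
  have hP0 : 0 ≤ P := by rw [hPdef]; positivity
  have h := sum_norm_curl_gaugeDir_le Pr hW hWx μ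
  have hM34 : x ^ 2 * M ^ 3 ≤ (M ^ 2 * x) ^ 2 := by
    have h3 : M ^ 3 ≤ M ^ 4 := pow_le_pow_right₀ hM1 (by norm_num)
    nlinarith [sq_nonneg x]
  calc x * ∑ p ∈ perWin d Pr, ‖curl W (gaugeDir W μ) p‖
      ≤ x * (2 * x * P * ∑ z ∈ periodBox (d := d) Pr, ‖μ z‖) := mul_le_mul_of_nonneg_left h hx
    _ ≤ x * (2 * x * P * (m₁ * M ^ 3 * E ^ 2)) := by gcongr
    _ = 2 * P * (x ^ 2 * M ^ 3) * m₁ * E ^ 2 := by ring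
    _ ≤ 2 * P * (M ^ 2 * x) ^ 2 * m₁ * E ^ 2 := by
        have h0 : 0 ≤ m₁ * E ^ 2 := by positivity
        have := mul_le_mul_of_nonneg_right (mul_le_mul_of_nonneg_left hM34 (by positivity : 0 ≤ 2 * P)) h0
        linarith [this]

/-! ## §2 The decomposition of a top-normalised representative, modulo the three masses -/

/-- **ROAD-Γ′ S5-CONDITIONAL — THE `hdecomp♭` SPLIT AND ITS TWO LETTERS FROM A TOP-NORMALISED REPRESENTATIVE, MODULO THE THREE MASSES OF THE SLICE-CORRECTING GENERATOR.**
Setting of S4a (`NE7TopNormalisedResidualLetters.tangentResidual_letters_of_frameTrivial`: NE7's pair `U_A^{u} = W·e^{X}` with `u` corner-trivial, common `(j+1)`-fold average, tower class at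
`W` of period `N·M`, row NE3's W6 regime, the Prop-4∕(Γ1) regime in `α₀, b`, the ℓ¹ tower line, `44dL·Mb ≤ 1`, TRIVIAL TOP FRAME `v_{j+1} ≡ 1`, ceilings `Γ₁…Γ₄`) plus `2 ≤ L^d` and
the MASS HYPOTHESIS `hμ`: every skew periodic corner-trivial `μ` that puts the tangent residual `X − X_N⁰` into `T_♮(W)` has `dirSq (gaugeDir W μ) ≤ m₂M²‖X‖_w²`, `Σ‖μ‖² ≤ p₂M⁴‖X‖_w²`,
`Σ‖μ‖ ≤ m₁M³‖X‖_w²` over the period box.  CONCLUSION: `X = X_T + X_N`, `X_T ∈ frameFreeBlockLandauW L N (j+1) W`, `X_N` skew, `‖X_N‖_w ≤ ν‖X‖_w`, `x·Σ_{perWin(N·M)}‖curl_W X_N‖ ≤ κ‖X‖_w²`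
with `ν = ν_S + ν_R + √(4(M²x)²·#Plane·p₂ + m₂)` and `κ = κ_S + κ_R + 2·#Plane·(M²x)²·m₁` (`ν_S, ν_R, κ_S, κ_R` of S4a). [folklore] -/
theorem decomp_of_topNormalised [Nonempty n] {L N : ℕ} [NeZero N] (hL : 2 ≤ L) (hLd : 2 ≤ L ^ d) (hN : 1 ≤ N) (j : ℕ)
    {W UA D : Site d → Fin d → (Matrix n n ℂ)ˣ} {u : Site d → (Matrix n n ℂ)ˣ} {x : ℝ} (hWu : IsUnitaryCfg W) (hWP : IsPeriodicCfg W ((N * L ^ (j + 1) : ℕ) : ℤ))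
    (hx : 0 ≤ x) (hsm : LevelSmall d L j x) (hWx : SmallField W x)
    (hθ : cruxC d L * (((L : ℝ) ^ (j + 1)) ^ 2 * x) < 1) (hθl : thetaLoc d L * (((L : ℝ) ^ (j + 1)) ^ 2 * x) < 1) (hε : ((L : ℝ) ^ (j + 1)) ^ 2 * x ≤ 1)
    {α₀ b : ℝ} (hα : 0 < α₀) (hα3 : C0 d * (2 * α₀) ≤ 1 / 3) (hα4 : 4 * (2 * α₀) ≤ c2' d L)
    (h52 : pdev W < α₀ * (((L : ℝ) ^ (j + 1))⁻¹) ^ 2) (hb : 0 ≤ b)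
    {X : Site d → Fin d → Matrix n n ℂ} (hX : ∀ (y : Site d) (κ : Fin d), ‖X y κ‖ ≤ b) (hXP : IsPeriodicDir X ((N * L ^ (j + 1) : ℕ) : ℤ)) (hXs : IsSkewDir X)
    (hsmall : Real.exp (4 * (800 * ((d : ℝ) + 1) ^ 2 * ((d : ℝ) + 4)) * α₀)
      * (1 + 8 * (131072 * ((d : ℝ) + 1) ^ 2) * ((L : ℝ) ^ (j + 1) * b)) ≤ 2)
    (hc₃ : 4 * ((L : ℝ) ^ (j + 1) * b) ≤ c3 d L)
    (hK : 16 * (C1cov d * (L : ℝ) ^ 2 * Real.sqrt (d * (2 * (2 * L) + 1) ^ d)) * (L : ℝ) ^ (j + 1) * b ≤ Real.sqrt ((L : ℝ) ^ 2 / (L : ℝ) ^ d))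
    (hS1 : (16 * (d + 1) * (d + 4) * (L : ℝ) ^ 2 * Csup d L * (d * (2 * nbRad d L + 1) ^ d)) * radSum d L j x ≤ ((L : ℝ) / (L : ℝ) ^ d) / 2)
    (h44 : 44 * ((d : ℝ) * L * ((L : ℝ) ^ (j + 1) * b)) ≤ 1)
    (hrep : gaugeAct u UA = vary W X 1) (hcorner : ∀ z : Site d, u (((L : ℤ) ^ (j + 1)) • z) = 1)
    (hA : avgIter L UA (j + 1) = D) (hW : avgIter L W (j + 1) = D)
    (hv1 : ∀ z : Site d, vcov L W (relPert W X) (j + 1) z = 1)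
    {Γ₁ Γ₂ Γ₃ Γ₄ : ℝ} (hΓ₁ : ∑ m ∈ range (j + 1), (L : ℝ) ^ m * ((L : ℝ) ^ 2 / (L : ℝ) ^ d) ^ m ≤ Γ₁)
    (hΓ₂ : ((j : ℝ) + 1) * ∑ i ∈ range j, ((L : ℝ) ^ 2 * ((L : ℝ) ^ 2 / (L : ℝ) ^ d)) ^ i ≤ Γ₂ * ((L : ℝ) ^ (j + 1)) ^ 2)
    (hΓ₃ : ∑ i ∈ range j, (((L : ℝ) / (L : ℝ) ^ d) * L) ^ i ≤ Γ₃) (hΓ₄ : ∑ m ∈ range (j + 1), ((L : ℝ) ^ 2 / (L : ℝ) ^ d) ^ m ≤ Γ₄)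
    {m₂ p₂ m₁ : ℝ} (hm₂ : 0 ≤ m₂) (hp₂ : 0 ≤ p₂) (hm₁ : 0 ≤ m₁)
    (hμ : ∀ (hYs : IsSkewDir (dirIter L (j + 1) W (fun y ν => X y ν - gaugeDir W (spikeW (L ^ (j + 1)) (framePotW L (j + 1) W X)) y ν)))
        (mu : Site d → Matrix n n ℂ), (∀ y, mu y ∈ skewAdjoint (Matrix n n ℂ)) →
        (∀ (y : Site d) (i : Fin d), mu (y + ((N * L ^ (j + 1) : ℕ) : ℤ) • e i) = mu y) → (∀ w : Site d, mu (((L : ℤ) ^ (j + 1)) • w) = 0) →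
        (fun y ν => (X y ν - (gaugeDir W (spikeW (L ^ (j + 1)) (framePotW L (j + 1) W X)) + rightInvW hL j hWu hx hsm hWx N hθ hYs) y ν) + gaugeDir W mu y ν)
          ∈ frameFreeBlockLandauW (d := d) (n := n) L N (j + 1) W →
        dirSq (gaugeDir W mu) (periodBox (d := d) (N * L ^ (j + 1))) ≤ m₂ * ((L : ℝ) ^ (j + 1)) ^ 2 * energyNormW L (j + 1) W X (periodBox (d := d) (N * L ^ (j + 1))) ^ 2
        ∧ ∑ z ∈ periodBox (d := d) (N * L ^ (j + 1)), ‖mu z‖ ^ 2 ≤ p₂ * ((L : ℝ) ^ (j + 1)) ^ 4 * energyNormW L (j + 1) W X (periodBox (d := d) (N * L ^ (j + 1))) ^ 2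
        ∧ ∑ z ∈ periodBox (d := d) (N * L ^ (j + 1)), ‖mu z‖ ≤ m₁ * ((L : ℝ) ^ (j + 1)) ^ 3 * energyNormW L (j + 1) W X (periodBox (d := d) (N * L ^ (j + 1))) ^ 2) :
    ∃ (XT XN : Site d → Fin d → Matrix n n ℂ) (ν κ : ℝ),
      X = XT + XN ∧ XT ∈ frameFreeBlockLandauW (d := d) (n := n) L N (j + 1) W ∧ IsSkewDir XN ∧ 0 ≤ ν ∧
      energyNormW L (j + 1) W XN (periodBox (d := d) (N * L ^ (j + 1))) ≤ ν * energyNormW L (j + 1) W X (periodBox (d := d) (N * L ^ (j + 1))) ∧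
      x * ∑ p ∈ perWin d (N * L ^ (j + 1)), ‖curl W XN p‖ ≤ κ * energyNormW L (j + 1) W X (periodBox (d := d) (N * L ^ (j + 1))) ^ 2 ∧
      ν = (2 * Real.sqrt (((Fintype.card (T4AveragingDeficitWall.Plane d) : ℝ) + d)
                * (8192 * ((d : ℝ) ^ 3 * (L : ℝ) ^ 5) * Γ₁ + 2048 * ((d : ℝ) * L) * (C1cov d * (L : ℝ) ^ 2 * Real.sqrt (d * (2 * (2 * L) + 1) ^ d)) ^ 2 * Γ₂))
                * ((L : ℝ) ^ (j + 1) * b)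
              + Real.sqrt ((l2C d L / (1 - thetaLoc d L * (((L : ℝ) ^ (j + 1)) ^ 2 * x)) ^ 2 + curl2C d L / (1 - thetaLoc d L * (((L : ℝ) ^ (j + 1)) ^ 2 * x)) ^ 2)
                  * (1024 * (C1cov d * (L : ℝ) ^ 2 * Real.sqrt (d * (2 * (2 * L) + 1) ^ d)) ^ 2 * ((L : ℝ) ^ d / (L : ℝ) ^ 4)))
                * ((L : ℝ) ^ (j + 1) * b))
            + Real.sqrt (4 * (((L : ℝ) ^ (j + 1)) ^ 2 * x) ^ 2 * (Fintype.card (T4AveragingDeficitWall.Plane d)) * p₂ + m₂) ∧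
      κ = (2 * (Fintype.card (T4AveragingDeficitWall.Plane d) : ℝ)
                * (16 * ((d : ℝ) * L) * (6 * Γ₁ + 2 * Γ₄) + 64 * (C1cov d * (L : ℝ) ^ 2 * (d * (2 * (2 * (L : ℝ)) + 1) ^ d)) * Γ₃)
                * (((L : ℝ) ^ (j + 1)) ^ 2 * x) ^ 2
              + (curl1C d L / (1 - thetaLoc d L * (((L : ℝ) ^ (j + 1)) ^ 2 * x))) * (((L : ℝ) ^ (j + 1)) ^ 2 * x)
                * (64 * (C1cov d * (L : ℝ) ^ 2 * (d * (2 * (2 * (L : ℝ)) + 1) ^ d)) * ((L : ℝ) ^ d / (L : ℝ) ^ 2)))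
            + 2 * (Fintype.card (T4AveragingDeficitWall.Plane d)) * (((L : ℝ) ^ (j + 1)) ^ 2 * x) ^ 2 * m₁ := by
  have hL1 : 1 ≤ L := by omega
  have hL0 : (0 : ℝ) < L := by exact_mod_cast (show 0 < L by omega)
  have hT : ((tower L N (j + 1) : ℕ) : ℤ) = ((N * L ^ (j + 1) : ℕ) : ℤ) := by rw [tower_eq_pow_mul, Nat.mul_comm]
  have hWPt : IsPeriodicCfg W ((tower L N (j + 1) : ℕ) : ℤ) := by rw [hT]; exact hWP
  set F := periodBox (d := d) (N * L ^ (j + 1)) with hF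
  set E : ℝ := energyNormW L (j + 1) W X F with hE
  have hE0 : 0 ≤ E := energyNormW_nonneg _ _ _ _ _
  -- S4a: the tangent residual and the letters of `X_N⁰`
  obtain ⟨hYs, XN0, hXN0, htan, hN0s, hN0P, hν0, hκ0⟩ :=
    tangentResidual_letters_of_frameTrivial hL hN j hWu hWP hx hsm hWx hθ hθl hε hα hα3 hα4 h52 hb hX hXP hXs hsmall hc₃ hK hS1 h44
      hrep hcorner hA hW hv1 hΓ₁ hΓ₂ hΓ₃ hΓ₄
  -- the tangent residual `Y' := X − X_N⁰`
  set Y' : Site d → Fin d → Matrix n n ℂ := fun y ν => X y ν - XN0 y ν with hY'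
  have hY's : IsSkewDir Y' := fun y ν => (skewAdjoint (Matrix n n ℂ)).sub_mem (hXs y ν) (hN0s y ν)
  have hY'P : IsPeriodicDir Y' ((tower L N (j + 1) : ℕ) : ℤ) := by
    rw [hT]; intro y i ν; simp only [hY']; rw [hXP y i ν, hN0P y i ν]
  have hY'T : TangentIter L j W Y' := (tangentIter_iff_dirIter_eq_zero L j W Y').mpr htan
  -- leaf-02: the corner-trivial slice-correcting generator
  obtain ⟨mu, hmus, hmuP, hmu0, hmem⟩ := exists_cornerGauge_mem_frameFreeBlockLandauW (M := N) hL1 hLd j hWu hWPt hx hsm hWx hY's hY'P hY'T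
  have hmuP' : ∀ (y : Site d) (i : Fin d), mu (y + ((N * L ^ (j + 1) : ℕ) : ℤ) • e i) = mu y := by rw [← hT]; exact hmuP
  -- the three masses
  have hmem' : (fun y ν => (X y ν - (gaugeDir W (spikeW (L ^ (j + 1)) (framePotW L (j + 1) W X)) + rightInvW hL j hWu hx hsm hWx N hθ hYs) y ν)
      + gaugeDir W mu y ν) ∈ frameFreeBlockLandauW (d := d) (n := n) L N (j + 1) W := by
    rw [← hXN0]; exact hmem
  obtain ⟨hD, hS2, hS1'⟩ := hμ hYs mu hmus hmuP' hmu0 hmem'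
  -- the pieces
  set G : Site d → Fin d → Matrix n n ℂ := gaugeDir W mu with hG
  have hGs : IsSkewDir G := gaugeDir_skew hWu hmus
  set P : ℝ := (Fintype.card (T4AveragingDeficitWall.Plane d) : ℝ) with hPdef
  set M : ℝ := (L : ℝ) ^ (j + 1) with hMdef
  -- the letters of the pure gauge piece
  have hνμ : energyNormW L (j + 1) W G F ≤ Real.sqrt (4 * (M ^ 2 * x) ^ 2 * P * p₂ + m₂) * E :=
    energyNormW_gaugeDir_le_of_masses hL1 j hWu hWx mu F hm₂ hp₂ hE0 hD hS2
  have hκμ : x * ∑ p ∈ perWin d (N * L ^ (j + 1)), ‖curl W G p‖ ≤ 2 * P * (M ^ 2 * x) ^ 2 * m₁ * E ^ 2 :=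
    curlL1_gaugeDir_le_of_mass hL1 j (N * L ^ (j + 1)) hWu hx hWx mu hm₁ hS1'
  -- positivity of the S4a constants
  set νS : ℝ := 2 * Real.sqrt ((P + d) * (8192 * ((d : ℝ) ^ 3 * (L : ℝ) ^ 5) * Γ₁ + 2048 * ((d : ℝ) * L) * (C1cov d * (L : ℝ) ^ 2 * Real.sqrt (d * (2 * (2 * L) + 1) ^ d)) ^ 2 * Γ₂))
      * (M * b) with hνS
  set νR : ℝ := Real.sqrt ((l2C d L / (1 - thetaLoc d L * (M ^ 2 * x)) ^ 2 + curl2C d L / (1 - thetaLoc d L * (M ^ 2 * x)) ^ 2)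
      * (1024 * (C1cov d * (L : ℝ) ^ 2 * Real.sqrt (d * (2 * (2 * L) + 1) ^ d)) ^ 2 * ((L : ℝ) ^ d / (L : ℝ) ^ 4))) * (M * b) with hνR
  set νμ : ℝ := Real.sqrt (4 * (M ^ 2 * x) ^ 2 * P * p₂ + m₂) with hνμdef
  have hνS0 : 0 ≤ νS := by rw [hνS]; positivity
  have hνR0 : 0 ≤ νR := by rw [hνR]; positivity
  have hνμ0 : 0 ≤ νμ := Real.sqrt_nonneg _
  set κS : ℝ := 2 * P * (16 * ((d : ℝ) * L) * (6 * Γ₁ + 2 * Γ₄) + 64 * (C1cov d * (L : ℝ) ^ 2 * (d * (2 * (2 * (L : ℝ)) + 1) ^ d)) * Γ₃) * (M ^ 2 * x) ^ 2 with hκS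
  set κR : ℝ := (curl1C d L / (1 - thetaLoc d L * (M ^ 2 * x))) * (M ^ 2 * x) * (64 * (C1cov d * (L : ℝ) ^ 2 * (d * (2 * (2 * (L : ℝ)) + 1) ^ d)) * ((L : ℝ) ^ d / (L : ℝ) ^ 2))
    with hκR
  set κμ : ℝ := 2 * P * (M ^ 2 * x) ^ 2 * m₁ with hκμdef
  refine ⟨fun y ν => Y' y ν + G y ν, XN0 - G, νS + νR + νμ, κS + κR + κμ, ?_, hmem, ?_, by positivity, ?_, ?_, rfl, rfl⟩
  · -- `X = X_T + X_N`
    funext y ν; simp only [hY', Pi.add_apply, Pi.sub_apply]; abel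
  · -- skewness of `X_N`
    intro y ν; simpa only [Pi.sub_apply] using (skewAdjoint (Matrix n n ℂ)).sub_mem (hN0s y ν) (hGs y ν)
  · -- the ν-letter
    have hsub := energyNormW_sub_le L (j + 1) W XN0 G F
    calc energyNormW L (j + 1) W (XN0 - G) F ≤ energyNormW L (j + 1) W XN0 F + energyNormW L (j + 1) W G F := hsub
      _ ≤ (νS + νR) * E + νμ * E := add_le_add hν0 hνμ
      _ = (νS + νR + νμ) * E := by ring
  · -- the κ-letter
    have hsum : ∑ p ∈ perWin d (N * L ^ (j + 1)), ‖curl W (XN0 - G) p‖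
        ≤ ∑ p ∈ perWin d (N * L ^ (j + 1)), ‖curl W XN0 p‖ + ∑ p ∈ perWin d (N * L ^ (j + 1)), ‖curl W G p‖ := by
      rw [← Finset.sum_add_distrib]
      refine Finset.sum_le_sum fun p _ => ?_
      rw [curl_sub_dir]; exact norm_sub_le _ _
    calc x * ∑ p ∈ perWin d (N * L ^ (j + 1)), ‖curl W (XN0 - G) p‖
        ≤ x * (∑ p ∈ perWin d (N * L ^ (j + 1)), ‖curl W XN0 p‖ + ∑ p ∈ perWin d (N * L ^ (j + 1)), ‖curl W G p‖) :=
          mul_le_mul_of_nonneg_left hsum hx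
      _ = x * ∑ p ∈ perWin d (N * L ^ (j + 1)), ‖curl W XN0 p‖ + x * ∑ p ∈ perWin d (N * L ^ (j + 1)), ‖curl W G p‖ := mul_add _ _ _
      _ ≤ (κS + κR) * E ^ 2 + κμ * E ^ 2 := add_le_add hκ0 hκμ
      _ = (κS + κR + κμ) * E ^ 2 := by ring

end

end Summit.QuantumFields.BalabanUV.T4Continuum.NE7DecompOfTopNormalised
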